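import Mathlib
import Literature.AlgebraicGeometry.Resolution.WeightedResolutionDatum
import Summits.ResolutionOfSingularities.ResolutionOfSingularities.Theses.WeightedInvariant

/-!
# `WeightedThesis` — the pieces of a regular weighted centre decrease

Support lemma for crux `stmt-ResolutionOfSingularities-0569`
(`Summit.ResolutionOfSingularities.ResolutionOfSingularities.Theses.WeightedInvariant.WeightedThesis`),
line `datum-glued-split` (RESHAPE 2), stub `stub_datumToHypersurfaceNonminimal` (tower half): the
GLOBAL cobordant blow-up of the library (`ReesFiltration.cobordantBlowup`,
`CobordantBlowupGlobal.lean`) is built from a DESCENDING multiplicative filtration of ideal sheaves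
(`ReesFiltration.antitone`), whereas the datum's centre is a bare `ReesAlgebraData` (pieces,
`R₀ = 𝒪`, `Rₘ Rₙ ⊆ Rₘ₊ₙ`, no monotonicity). Under the guard of axiom `(iii)` the centre is a
REGULAR WEIGHTED CENTRE, and then its pieces do decrease:

* `ReesAlgebraData.antitone_piece_of_isRegularWeightedCentre` — if every point has a weighted
  chart `(U, u, w)` (`Rₙ(U) = (u^α : Σ wᵢ αᵢ ≥ n)`), then `R₀ ⊇ R₁ ⊇ ⋯` (compare on the charts,
  which cover, `Scheme.IdealSheafData.le_of_iSup_eq_top`; on a chart the monomial ideals decrease,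
  `weightedMonomialIdeal_antitone`);
* `stub_antitone_piece_centre` — for a weighted resolution datum `D` over a perfect field and a
  pair `(f, X)` whose invariant is not everywhere minimal, `n ↦ (D.centre f X).piece n` is antitone.

No definition is declared.
-/

noncomputable section

open CategoryTheory AlgebraicGeometry TopologicalSpace
open Literature.AlgebraicGeometry.Resolution

set_option linter.dupNamespace false

namespace Summit.ResolutionOfSingularities.ResolutionOfSingularities.Theorems.WeightedThesis.CentreAntitone

universe u

/-- **The pieces of a regular weighted centre decrease.** If the Rees algebra `R` on `Y` has a
weighted chart around every point, then `Rₙ ⊆ Rₘ` for `m ≤ n`. [cite: Wlodarczyk2022, 2.1.10 and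
Lemma 2.1.12] -/
theorem ReesAlgebraData.antitone_piece_of_isRegularWeightedCentre {Y : Scheme.{u}}
    (R : ReesAlgebraData Y) (h : R.IsRegularWeightedCentre) : Antitone R.piece := by
  intro m n hmn
  -- the charts, indexed by the points of `Y`, cover `Y`
  choose U hyU k u w hchart using h
  have hcover : ⨆ y : Y, ((U y : Y.affineOpens) : Y.Opens) = ⊤ :=
    top_le_iff.mp fun y _ => Opens.mem_iSup.mpr ⟨y, hyU y⟩
  refine Scheme.IdealSheafData.le_of_iSup_eq_top U hcover fun y => ?_
  rw [(hchart y).ideal_eq n, (hchart y).ideal_eq m]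
  exact weightedMonomialIdeal_antitone (u y) (w y) hmn

/-- **The pieces of the datum's centre decrease** (under the guard of axiom `(iii)`): for a
weighted resolution datum `D` in characteristic `p`, a smooth separated quasi-compact
`f : Y → Spec k` over a perfect field and an ideal sheaf `X` on `Y` whose invariant is not everywhere
minimal, `(D.centre f X).piece` is antitone — so the centre defines a `ReesFiltration` and has a
global cobordant blow-up `Spec_Y ⊕ₙ Rₙ tⁿ`. [cite: Wlodarczyk2022, 2.1.10] -/
theorem stub_antitone_piece_centre :
    ∀ {p : ℕ} (D : Literature.AlgebraicGeometry.Resolution.WeightedResolutionDatum p) {k : Type} [Field k] [CharP k p] [PerfectField k] {Y : AlgebraicGeometry.Scheme.{0}} (f : Y ⟶ AlgebraicGeometry.Spec (.of k)) [AlgebraicGeometry.Smooth f] [AlgebraicGeometry.IsSeparated f] [AlgebraicGeometry.QuasiCompact f] (X : Y.IdealSheafData), (∃ y : Y, ¬ IsBot (D.inv f X y)) → Antitone (D.centre f X).piece :=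
  fun D _ _ _ _ _ f _ _ _ X h =>
    ReesAlgebraData.antitone_piece_of_isRegularWeightedCentre _ (D.isRegularWeightedCentre_centre f X h)

end Summit.ResolutionOfSingularities.ResolutionOfSingularities.Theorems.WeightedThesis.CentreAntitone

end
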